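import Summits.HubbardSuperconductivity.HubbardLadder.ClusterCutBlocks
import Summits.HubbardSuperconductivity.HubbardLadder.Oct12It4Invariance
import Summits.HubbardSuperconductivity.HubbardLadder.PairOpTable
import HarnessLib

/-!
# Cluster pair-cuts: the integer pair list of cut it4_s4b and `xIt4 = 2 • X_P`

HONEST FRAMING: ladder R1–R4 with certified numbers; no claim on H/H₀.  Cell pub-hubbard, lane r2-eng-1 (g13).  Data of the cut of record
`cut_oct12_adv15oct12it4_s4b.json` b549640712040acb (σ = −931/5000, `DEN = 10⁶`): the kernel-side integer pair list `it4P` (one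
orientation `(i, j, DEN·a_o)` per pair of orbit `o`, 66 pairs, sites in the order of `Oct12Representation`), `pairsOK 12 it4P` (kernel),
and the identity with the tree's symmetric table `wSymIt4` (Oct12It4Invariance): `wSymIt4 i j = T i j + T j i` for `T = tableOfPairList it4P`
(kernel), hence `xIt4 = 2 • pairOp it4P` (`weightedPairOp_of_symmetrised`, PairOpTable).  The per-piece kernel certificates
`ClusterCutOct12It4FrameNN` are stated for `pairOp it4P`.  All statements [folklore].
-/

namespace Summit.HubbardSuperconductivity.HubbardLadder.ClusterCut

open Matrix Literature.MathematicalPhysics.QuantumLattice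

/-- The integer pair list of cut it4_s4b: one orientation `(i, j, DEN·a_o)` per pair of orbit `o` (`DEN = 10⁶`; 66 pairs). -/
def it4P : NatPairList :=
  [(0, 1, -2012), (0, 2, 11946), (0, 3, 37635), (0, 4, -7322), (0, 5, -4490), (0, 6, -4490),
   (0, 7, -5259), (0, 8, -17610), (0, 9, -2272), (0, 10, -6057), (0, 11, -1026), (1, 2, -4490),
   (1, 3, -7322), (1, 4, 37635), (1, 5, 11946), (1, 6, -2272), (1, 7, -17610), (1, 8, -5259),
   (1, 9, -4490), (1, 10, -1026), (1, 11, -6057), (2, 3, 37635), (2, 4, -5259), (2, 5, -6057),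
   (2, 6, -2012), (2, 7, -7322), (2, 8, -17610), (2, 9, -1026), (2, 10, -4490), (2, 11, -2272),
   (3, 4, 67914), (3, 5, -5259), (3, 6, -7322), (3, 7, 67914), (3, 8, -28277), (3, 9, -17610),
   (3, 10, -5259), (3, 11, -17610), (4, 5, 37635), (4, 6, -17610), (4, 7, -28277), (4, 8, 67914),
   (4, 9, -7322), (4, 10, -17610), (4, 11, -5259), (5, 6, -1026), (5, 7, -17610), (5, 8, -7322),
   (5, 9, -2012), (5, 10, -2272), (5, 11, -4490), (6, 7, 37635), (6, 8, -5259), (6, 9, -6057),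
   (6, 10, 11946), (6, 11, -4490), (7, 8, 67914), (7, 9, -5259), (7, 10, 37635), (7, 11, -7322),
   (8, 9, 37635), (8, 10, -7322), (8, 11, 37635), (9, 10, -4490), (9, 11, 11946), (10, 11, -2012)]

/-- Kernel: in every pair of `it4P` the sites are `< 12` and distinct. -/
theorem it4P_ok : pairsOK 12 it4P = true := by decide

/-- Kernel: the tree's symmetric weight table `wSymIt4` is the symmetrisation of the pair list's table. -/
theorem wSymIt4_eq_symmetrised : ∀ i j : Fin 12,
    wSymIt4 i j = tableOfPairList (toPairList 12 it4P (by norm_num)) i j +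
      tableOfPairList (toPairList 12 it4P (by norm_num)) j i := by
  decide +kernel

/-- Hence `xIt4 = 2 • X_P` for the integer pair operator `X_P = pairOp it4P`. [folklore] -/
theorem xIt4_eq_two_smul_pairOp : xIt4 = (2 : ℂ) • pairOp (toPairList 12 it4P (by norm_num)) :=
  weightedPairOp_of_symmetrised _ wSymIt4 wSymIt4_eq_symmetrised

end Summit.HubbardSuperconductivity.HubbardLadder.ClusterCut
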